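import Literature.RepresentationTheory.BorelWallach2000.AdmissibleFiniteCochains
import Literature.RepresentationTheory.KonnoKonno2007.JunctionLinearRealGroup
import Literature.NumberTheory.Automorphic.GKModules
import Mathlib.RingTheory.Finiteness.Finsupp
import HarnessLib

/-!
# FLOOR-0 P3b «ENGINE local packets», line `F0_EngineLocalPackets` — STUB T6d CLOSED: the admissibility bridge
# `IsAdmissibleGK ⇒ IsKAdmissible` (finite multiplicity of irreducible `K`-types ⇒ `V_{(W)}` finite for every finite-dimensional `W`)

Cell hodgecm-mathlib (D-0151), FLOOR 0, crux item H413 = stmt-HodgeConjecture-24833; sub-line `Cruxes/H413/Lines/F0_EngineLocalPackets.lean`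
(F0P3b-plan (g0), edition 1, sha16 808dda7dd1cd10bb), registered stub `stub_T6d_admissibleBridge : StubT6dAdmissibleBridge` (§2 there).  PROOF
lane (theorems only); author A-p12 (g12).  Per the cell's stub-closer protocol (director s347) the Lines module is NOT imported: the theorem's
TYPE is the body of `…Cruxes.H413.F0EngineLocalPackets.StubT6dAdmissibleBridge` BINDER FOR BINDER, and the by-name fold
`theorem stub_T6d_admissibleBridge : StubT6dAdmissibleBridge := F0P3bStubT6dAdmissibleBridge.stubT6d_holds` goes into the line at its next edition.

Content.  The line's `IsAdmissibleGK ρK` ([KnappVogan1995, §I.3]: every IRREDUCIBLE finite-dimensional `K`-type `τ` has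
`Hom_K(τ, V)` finite-dimensional) implies Borel–Wallach's `IsKAdmissible ρK` ([BorelWallach2000, 0 §2.4–2.5]: `V_{(W)}` finite-dimensional
for EVERY finite-dimensional `K`-module `W`), for ANY group `K` and any representation — no topology, no `(𝔤, K)`-structure and no complete
reducibility is needed (the line's `IsGKModule` hypothesis is carried but unused): `Hom_K(−, V)` is left exact, so for a subrepresentation
`P ⊆ W` the restriction `Hom_K(W, V) → Hom_K(P, V)` has kernel embedded in `Hom_K(W ⧸ P, V)`; an induction on `dim W` (split off a proper
non-zero subrepresentation when `W` is reducible and non-zero) bounds `Hom_K(W, V)` by the irreducible case, and the tree's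
★ `isKAdmissible_of_finite_intertwiningMap` ([BorelWallach2000, 0 §2.4]: `V_{(W)}` is a quotient of `Hom_K(W, V) ⊗ W`) concludes.  With the
tree's ★ `moduleFinite_gkComplex_carrier_of_isKAdmissible` this is what makes every cochain space `C^q(𝔤, K; V)` finite-dimensional for the
tree's admissible `(𝔤, K)`-modules (the line's derived head `cochainsFinite_of_T6d`, [BorelWallach2000, II Prop. 3.4 (1)]).

HC_CM is proved only modulo the 7 printed citations until rung 0 closes; this closes ONE generic stub (T6d) of ONE floor-0 sub-line.

## References
* [BorelWallach2000] A. Borel, N. Wallach, *Continuous Cohomology, Discrete Subgroups, and Representations of Reductive Groups*, 2nd ed.,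
  AMS 2000 — 0 §2.4–2.5 (admissible `K`-modules, `V_{(W)}`), II Prop. 3.4 (1).
* [KnappVogan1995] A. Knapp, D. Vogan, *Cohomological Induction and Unitary Representations*, Princeton 1995 — §I.3 (before Prop. 1.63:
  admissible = each `K`-type has finite multiplicity).
-/

-- Mathlib idiom (as in `GKModules`, the `Upq*` files and the line): commutator bracket on `Module.End`
attribute [local instance 100] LieRing.ofAssociativeRing

set_option autoImplicit false
set_option linter.dupNamespace false

noncomputable section

namespace Summit.HodgeConjecture.HodgeConjecture.Cruxes.H413.F0P3bStubT6dAdmissibleBridge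

open Literature.NumberTheory.Automorphic
open Literature.RepresentationTheory.BorelWallach2000
open Literature.RepresentationTheory.KonnoKonno2007 Literature.RepresentationTheory.KonnoKonno2007.RealDualPair
open Literature.RepresentationTheory.KonnoKonno2007.RealDualPair.UForm

/-! ## §1 Generic: finite `Hom_K` from irreducible `K`-types to all finite-dimensional `K`-modules (left exactness of `Hom_K(−, V)`) -/

section Generic

variable {K : Type*} [Group K] {V : Type*} [AddCommGroup V] [Module ℂ V] (ρ : Representation ℂ K V)

/-- **Restriction to a subrepresentation has kernel controlled by the quotient**: for a subrepresentation `P` of a `K`-module `(W, τ)`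
and any `K`-module `(V, ρ)`, if `Hom_K(P, V)` and `Hom_K(W ⧸ P, V)` are finite-dimensional then so is `Hom_K(W, V)` — the restriction map
`Hom_K(W, V) → Hom_K(P, V)` is linear and every `K`-map vanishing on `P` factors through `W ⧸ P` (left exactness of `Hom_K(−, V)`;
Mathlib `Module.Finite.of_submodule_quotient` on its kernel). [folklore] -/
theorem finiteDimensional_intertwiningMap_of_subrepresentation {W : Type*} [AddCommGroup W] [Module ℂ W]
    (τ : Representation ℂ K W) (P : Subrepresentation τ)
    (hP : FiniteDimensional ℂ (P.toRepresentation.IntertwiningMap ρ))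
    (hQ : FiniteDimensional ℂ
      ((τ.quotient P.toSubmodule fun g _ hw => P.apply_mem_toSubmodule g hw).IntertwiningMap ρ)) :
    FiniteDimensional ℂ (τ.IntertwiningMap ρ) := by
  classical
  -- the inclusion `P ↪ W` as a `K`-map and the restriction `R : Hom_K(W, V) → Hom_K(P, V)`
  let incl : P.toRepresentation.IntertwiningMap τ :=
    P.toSubmodule.subtype.intertwiningMap_of_isIntertwiningMap P.toRepresentation τ (fun g w => rfl)
  let R : τ.IntertwiningMap ρ →ₗ[ℂ] P.toRepresentation.IntertwiningMap ρ :=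
    { toFun := fun f => f.comp incl
      map_add' := fun f₁ f₂ => Representation.IntertwiningMap.ext (LinearMap.ext fun _ => rfl)
      map_smul' := fun a f => Representation.IntertwiningMap.ext (LinearMap.ext fun _ => rfl) }
  -- the quotient representation and the lift `ker R → Hom_K(W ⧸ P, V)`
  let τq : Representation ℂ K (W ⧸ P.toSubmodule) := τ.quotient P.toSubmodule fun g _ hw => P.apply_mem_toSubmodule g hw
  have hker : ∀ f : LinearMap.ker R, P.toSubmodule ≤ LinearMap.ker (f : τ.IntertwiningMap ρ).toLinearMap := by
    intro f w hw
    have h1 : (f : τ.IntertwiningMap ρ) w = (R f) ⟨w, hw⟩ := rfl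
    rw [LinearMap.mem_ker]
    change (f : τ.IntertwiningMap ρ) w = 0
    rw [h1, LinearMap.mem_ker.1 f.2]
    rfl
  let L : LinearMap.ker R →ₗ[ℂ] τq.IntertwiningMap ρ :=
    { toFun := fun f => (P.toSubmodule.liftQ (f : τ.IntertwiningMap ρ).toLinearMap (hker f)).intertwiningMap_of_isIntertwiningMap
          τq ρ (by
            intro g x
            induction x using Submodule.Quotient.induction_on with
            | H w =>
              change P.toSubmodule.liftQ _ (hker f) (τq g (Submodule.Quotient.mk w)) = _
              rw [Representation.quotient_apply, Submodule.mapQ_apply, Submodule.liftQ_apply, Submodule.liftQ_apply]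
              exact Representation.IntertwiningMap.isIntertwining τ ρ (f : τ.IntertwiningMap ρ) g w)
      map_add' := fun f₁ f₂ => by
        apply Representation.IntertwiningMap.ext
        apply Submodule.linearMap_qext
        ext w
        rfl
      map_smul' := fun a f => by
        apply Representation.IntertwiningMap.ext
        apply Submodule.linearMap_qext
        ext w
        rfl }
  have hL : Function.Injective L := by
    intro f₁ f₂ h
    have h' : P.toSubmodule.liftQ (f₁ : τ.IntertwiningMap ρ).toLinearMap (hker f₁) =
        P.toSubmodule.liftQ (f₂ : τ.IntertwiningMap ρ).toLinearMap (hker f₂) :=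
      congrArg Representation.IntertwiningMap.toLinearMap h
    have h'' := congrArg (fun g => g ∘ₗ P.toSubmodule.mkQ) h'
    simp only [Submodule.liftQ_mkQ] at h''
    exact Subtype.ext (Representation.IntertwiningMap.ext h'')
  -- `ker R` and `Hom_K(W, V) ⧸ ker R ≅ range R ⊆ Hom_K(P, V)` are finite-dimensional
  haveI : FiniteDimensional ℂ (LinearMap.ker R) := Module.Finite.of_injective L hL
  haveI : FiniteDimensional ℂ (τ.IntertwiningMap ρ ⧸ LinearMap.ker R) :=
    Module.Finite.equiv R.quotKerEquivRange.symm
  exact Module.Finite.of_submodule_quotient (LinearMap.ker R)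

/-- **Finite multiplicity of the irreducible `K`-types gives finite `Hom_K(W, V)` for EVERY finite-dimensional `K`-module `W`** (any group
`K`, any representation `V`): induction on `dim W` — a reducible non-zero `W` has a proper non-zero subrepresentation `P`, and
`finiteDimensional_intertwiningMap_of_subrepresentation` reduces to `P` and `W ⧸ P`, both of smaller dimension.
[cite: KnappVogan1995, §I.3 (before Prop. 1.63)] [cite: BorelWallach2000, 0 §2.4] -/
theorem finiteDimensional_intertwiningMap_of_irreducibles
    (h : ∀ (W : Type) [AddCommGroup W] [Module ℂ W] [FiniteDimensional ℂ W] (τ : Representation ℂ K W),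
      τ.IsIrreducible → FiniteDimensional ℂ (τ.IntertwiningMap ρ)) :
    ∀ (n : ℕ) (W : Type) [AddCommGroup W] [Module ℂ W] [FiniteDimensional ℂ W] (τ : Representation ℂ K W),
      Module.finrank ℂ W ≤ n → FiniteDimensional ℂ (τ.IntertwiningMap ρ) := by
  intro n
  induction n with
  | zero =>
    intro W _ _ _ τ hW
    haveI : Subsingleton W := Module.finrank_zero_iff.1 (Nat.le_zero.1 hW)
    haveI : Subsingleton (W →ₗ[ℂ] V) := inferInstance
    haveI : Subsingleton (τ.IntertwiningMap ρ) :=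
      ⟨fun f g => Representation.IntertwiningMap.ext (Subsingleton.elim _ _)⟩
    change Module.Finite ℂ _
    rw [Module.finite_def, Subsingleton.elim (⊤ : Submodule ℂ (τ.IntertwiningMap ρ)) ⊥]
    exact Submodule.fg_bot
  | succ n ih =>
    intro W _ _ _ τ hW
    by_cases hirr : τ.IsIrreducible
    · exact h W τ hirr
    by_cases hW0 : Subsingleton W
    · haveI : Subsingleton (W →ₗ[ℂ] V) := inferInstance
      haveI : Subsingleton (τ.IntertwiningMap ρ) :=
        ⟨fun f g => Representation.IntertwiningMap.ext (Subsingleton.elim _ _)⟩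
      change Module.Finite ℂ _
      rw [Module.finite_def, Subsingleton.elim (⊤ : Submodule ℂ (τ.IntertwiningMap ρ)) ⊥]
      exact Submodule.fg_bot
    -- `W ≠ 0` reducible: a proper non-zero subrepresentation `P`
    have hbt : (⊥ : Subrepresentation τ) ≠ ⊤ := by
      intro hbt
      apply hW0
      have hbt' : (⊥ : Submodule ℂ W) = ⊤ := congrArg Subrepresentation.toSubmodule hbt
      exact subsingleton_of_forall_eq 0 fun w =>
        (Submodule.mem_bot ℂ).1 (hbt'.symm ▸ (show w ∈ (⊤ : Submodule ℂ W) from Submodule.mem_top))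
    obtain ⟨P, hP0, hP1⟩ : ∃ P : Subrepresentation τ, P ≠ ⊥ ∧ P ≠ ⊤ := by
      by_contra hcon
      haveI : Nontrivial (Subrepresentation τ) := ⟨⟨⊥, ⊤, hbt⟩⟩
      refine hirr ⟨fun P => ?_⟩
      by_cases hP : P = ⊥
      · exact Or.inl hP
      · by_cases hP' : P = ⊤
        · exact Or.inr hP'
        · exact (hcon ⟨P, hP, hP'⟩).elim
    have hP0' : P.toSubmodule ≠ ⊥ := fun h0 => hP0 (Subrepresentation.toSubmodule_injective h0)
    have hP1' : P.toSubmodule ≠ ⊤ := fun h1 => hP1 (Subrepresentation.toSubmodule_injective h1)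
    -- dimensions drop on both sides
    have hdimP : Module.finrank ℂ P.toSubmodule ≤ n := by
      have := Submodule.finrank_lt hP1'
      omega
    have hdimQ : Module.finrank ℂ (W ⧸ P.toSubmodule) ≤ n := by
      have h1 := Submodule.finrank_quotient_add_finrank P.toSubmodule
      have h2 : 0 < Module.finrank ℂ P.toSubmodule := by
        rw [Module.finrank_pos_iff_exists_ne_zero]
        obtain ⟨w, hw, hw0⟩ := (Submodule.ne_bot_iff _).1 hP0'
        exact ⟨⟨w, hw⟩, fun h0 => hw0 (congrArg Subtype.val h0)⟩
      omega
    exact finiteDimensional_intertwiningMap_of_subrepresentation ρ τ P (ih _ P.toRepresentation hdimP) (ih _ _ hdimQ)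

/-- **`IsAdmissibleGK ⇒ IsKAdmissible`** for a representation of any group `K` (of `Type`) on a complex vector space: finite multiplicity of the
irreducible finite-dimensional `K`-types ([KnappVogan1995, §I.3]) implies `V_{(W)}` finite-dimensional for every finite-dimensional `W`
([BorelWallach2000, 0 §2.4], ★ `isKAdmissible_of_finite_intertwiningMap`). [cite: BorelWallach2000, 0 §2.4–2.5] [cite: KnappVogan1995, §I.3 (before Prop. 1.63)] -/
theorem isKAdmissible_of_finite_irreducibles {K : Type} [Group K] {V : Type*} [AddCommGroup V] [Module ℂ V]
    (ρ : Representation ℂ K V)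
    (h : ∀ (W : Type) [AddCommGroup W] [Module ℂ W] [FiniteDimensional ℂ W] (τ : Representation ℂ K W),
      τ.IsIrreducible → FiniteDimensional ℂ (τ.IntertwiningMap ρ)) :
    IsKAdmissible ρ :=
  isKAdmissible_of_finite_intertwiningMap fun W _ _ _ τ =>
    finiteDimensional_intertwiningMap_of_irreducibles ρ h (Module.finrank ℂ W) W τ le_rfl

end Generic

/-! ## §2 The stub, binder for binder -/

/-- **STUB T6d of sub-line `F0_EngineLocalPackets`, proved** — the body of `StubT6dAdmissibleBridge` binder for binder: for every
`(𝔤, K)`-module `(ρK, ρ𝔤)` of `U(α, β) = uFormGroup α β` that is admissible in the `Hom_K(τ, V)`-sense (`IsAdmissibleGK`), `ρK` is admissible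
as `K`-module in Borel–Wallach's sense (`IsKAdmissible`).  (The `IsGKModule` hypothesis is not needed and not used.)
[cite: BorelWallach2000, 0 §2.4–2.5, II Prop. 3.4 (1)] [cite: KnappVogan1995, §I.3 (before Prop. 1.63)] -/
theorem stubT6d_holds :
    ∀ (α β : Type) [Fintype α] [DecidableEq α] [Fintype β] [DecidableEq β]
    (V : Type) [AddCommGroup V] [Module ℂ V]
    (ρK : Representation ℂ (uFormGroup α β).maximalCompact V) (ρ𝔤 : (uFormGroup α β).lie →ₗ⁅ℝ⁆ Module.End ℂ V),
    IsGKModule (uFormGroup α β) ρK ρ𝔤 → IsAdmissibleGK ρK → IsKAdmissible ρK := by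
  intro α β _ _ _ _ V _ _ ρK ρ𝔤 _ hadm
  exact isKAdmissible_of_finite_irreducibles ρK fun W _ _ _ τ hτ => hadm W τ hτ

end Summit.HodgeConjecture.HodgeConjecture.Cruxes.H413.F0P3bStubT6dAdmissibleBridge

end
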